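import Summits.ABC.IUTFork.Conditional.AbcOfSGenuineKChosenDepthHexSharpLocalType
import HarnessLib

/-!
# Branch C «HEX-SHARP» with the LOCAL TYPE at `7`, sharp window `60·l < 6·7³` (`l ≤ 34`): the kernel HEX frontier is
# `k ≥ 13` at `l = 11`, `k ≥ 12` at `l = 13`, `k ≥ 11` at every prime `17 ≤ l ≤ 31` — UNCONDITIONALLY

PROOF-ONLY file (0 definitions, 0 `Prop` facts, no instance) of the abc-iut cell (seat abc-iut-w5-d163, gen 7; HEX-SHARP prover #1 / LT-c; sequel of
`AbcOfSGenuineKChosenDepthHexSharpLocalType` p459266). TAKES NO SIDE on [IUTchIII] Cor. 3.12 or on any author.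

p459266 discharged the local-type hypothesis with `E = 60·l` through the `n = 4` window of p458036 (`E < 6·7⁴`), giving `15/14/13`. But for `l ≤ 34`
one has `60·l ≤ 2040 < 2058 = 6·7³`, i.e. `b = ⌊log₇(7e/6)⌋ ≤ 3` already (abc-iut-W-neg-1's remark 17:46:45Z, «`10·l < 7^B`»), so the parametric
engine `GenuineK.exists_deep_place_lamSeven_of_ramBound` (p458036 §1) applies with `n := 3`, `E := 60·l` and the bound
`GenuineK.absRamificationIdx_kOf_le_sixty_mul` (p459266 §1):

* **`GenuineK.exists_deep_place_lamSeven_localType_eleven'`** — `l = 11`: every `k ≥ 13` (`11·(12·42+20) = 5764 ≤ 6240 = 5·13·8·12`);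
* **`GenuineK.exists_deep_place_lamSeven_localType_thirteen'`** — `l = 13`: every `k ≥ 12` (`13·(14·42+20) = 7904 ≤ 8400`);
* **`GenuineK.exists_deep_place_lamSeven_localType_of_le_31`** — every prime `17 ≤ l ≤ 31`: every `k ≥ 11` (`13l² ≥ 172l + 165` for `l ≥ 17`).
(For `37 ≤ l ≤ 240` the `n = 4` corollary `…_localType_of_le_240` of p459266, `k ≥ 13`, stands.) Each gives the top-label packet over `7` deep at the CHOSEN
realising q-idele of every genuine Θ-volume datum over `(ratPoint λ_k, l)` — `hdeep` of abc-iut-C-cert-1's p438886 / of the parametric per-datum wrapper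
`GenuineK.not_pilotKummerCompatHull_lamSeven_of_ramBound` (p458728) with `n := 3`, `E := 60·l` ⇒ ¬S_H per datum, every binder.

HONEST SCOPE: SHARP reading; per-label licence STRONGER THAN PRINT; nothing about the printed GLOBAL inequality or the number-level Corollary; HEX data
Szpiro-GOOD (letter-C insulation); refuted-as-typed ≠ refuted-in-print; typed ≠ proved. The numerics of record (rw-num-lead F1-3) read ALLREF for `k ≥ 12`
at `l = 11, 13` (exact Tate type `e_x = 15/gcd(15,k)`), WINDOW for `k ≤ 9`. [cite: Mochizuki2012, IUTchIII Cor. 3.12 Step (xi-f) p. 184; IUTchIV Prop. 1.2 p. 10,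
Prop. 1.8 (vii) p. 19, Cor. 2.2 (ii) proof (P5) p. 46] [claim: Mochizuki2012, status: disputed] for every IUT quotation.
-/

noncomputable section

open NumberField IsDedekindDomain

namespace Summit.ABC.IUTFork.Conditional

open Thm311 Thm311.Real Cor312 Cor312Prov Literature.IUT.LogVolume Literature.IUT.HodgeTheaters
  Literature.IUT.LogThetaLattice Literature.NumberTheory.NumberFields Literature.NumberTheory.DiophantineGeometry.GenEll
  Literature.NumberTheory.DiophantineGeometry

/-- **HEX-SHARP with the local type, `l = 11`: every `k ≥ 13`** (`n = 3`, `E = 660 < 2058`). [cite: Mochizuki2012, IUTchIII Cor. 3.12 Step (xi-f) p. 184;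
IUTchIV Prop. 1.2 p. 10] [claim: Mochizuki2012, status: disputed] -/
theorem GenuineK.exists_deep_place_lamSeven_localType_eleven' {k : ℕ} (hk : 13 ≤ k)
    (T : Cor22.ThetaVolumeDatumAt (ratPoint ((2 : ℚ)⁻¹ + 2 / 7 ^ k)) 11) :
    letI := T.instFieldF; letI := T.instNumberFieldF; letI := T.instAlgebraF; letI := T.instFieldK
    letI := T.instNumberFieldK; letI := T.instAlgebraK; letI := T.instFieldFbar; letI := T.instAlgebraFbar
    letI := T.instAlgebraKFbar; letI := T.instIsElliptic
    haveI : Fact (Nat.Prime 7) := ⟨by norm_num⟩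
    ∃ (i : Fin (thetaIndex (pilotDataOfK T.D T.K)).lstar) (x₀ : (thetaIndex (pilotDataOfK T.D T.K)).Fibre (.inr ⟨7, by norm_num⟩)),
      (i : ℕ) = 4 ∧
      placeOf (pilotDataOfK T.D T.K) 7 x₀ ∈ (pilotDataOfK T.D T.K).S ∧
      (7 : ℝ) ^ ((((i : ℕ) : ℝ) + 2) * (differentOrd 7 (kOf (pilotDataOfK T.D T.K) 7 x₀)
          + logRadiusA 7 (absRamificationIdx 7 (kOf (pilotDataOfK T.D T.K) 7 x₀))
          + logRadiusB 7 (absRamificationIdx 7 (kOf (pilotDataOfK T.D T.K) 7 x₀))) + 1) *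
        ‖(exists_realising_qIdeles_pilotDataOfK T.D).choose ⟨7, by norm_num⟩ x₀‖ ^ (((i : ℕ) + 1) ^ 2 - 1) < 1 :=
  GenuineK.exists_deep_place_lamSeven_of_ramBound (n := 3) (E := 60 * 11) (by omega) (by norm_num) le_rfl (by norm_num)
    (by nlinarith) T (GenuineK.absRamificationIdx_kOf_le_sixty_mul (by omega) (by norm_num) le_rfl T)

/-- **HEX-SHARP with the local type, `l = 13`: every `k ≥ 12`** (`n = 3`, `E = 780 < 2058`). [cite: Mochizuki2012, IUTchIII Cor. 3.12 Step (xi-f) p. 184;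
IUTchIV Prop. 1.2 p. 10] [claim: Mochizuki2012, status: disputed] -/
theorem GenuineK.exists_deep_place_lamSeven_localType_thirteen' {k : ℕ} (hk : 12 ≤ k)
    (T : Cor22.ThetaVolumeDatumAt (ratPoint ((2 : ℚ)⁻¹ + 2 / 7 ^ k)) 13) :
    letI := T.instFieldF; letI := T.instNumberFieldF; letI := T.instAlgebraF; letI := T.instFieldK
    letI := T.instNumberFieldK; letI := T.instAlgebraK; letI := T.instFieldFbar; letI := T.instAlgebraFbar
    letI := T.instAlgebraKFbar; letI := T.instIsElliptic
    haveI : Fact (Nat.Prime 7) := ⟨by norm_num⟩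
    ∃ (i : Fin (thetaIndex (pilotDataOfK T.D T.K)).lstar) (x₀ : (thetaIndex (pilotDataOfK T.D T.K)).Fibre (.inr ⟨7, by norm_num⟩)),
      (i : ℕ) = 5 ∧
      placeOf (pilotDataOfK T.D T.K) 7 x₀ ∈ (pilotDataOfK T.D T.K).S ∧
      (7 : ℝ) ^ ((((i : ℕ) : ℝ) + 2) * (differentOrd 7 (kOf (pilotDataOfK T.D T.K) 7 x₀)
          + logRadiusA 7 (absRamificationIdx 7 (kOf (pilotDataOfK T.D T.K) 7 x₀))
          + logRadiusB 7 (absRamificationIdx 7 (kOf (pilotDataOfK T.D T.K) 7 x₀))) + 1) *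
        ‖(exists_realising_qIdeles_pilotDataOfK T.D).choose ⟨7, by norm_num⟩ x₀‖ ^ (((i : ℕ) + 1) ^ 2 - 1) < 1 :=
  GenuineK.exists_deep_place_lamSeven_of_ramBound (n := 3) (E := 60 * 13) (by omega) (by norm_num) (by norm_num) (by norm_num)
    (by nlinarith) T (GenuineK.absRamificationIdx_kOf_le_sixty_mul (by omega) (by norm_num) (by norm_num) T)

/-- **HEX-SHARP with the local type, every prime `17 ≤ l ≤ 31`: every `k ≥ 11`** (`n = 3`: `60·31 = 1860 < 2058`; `13l² ≥ 172l + 165`).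
[cite: Mochizuki2012, IUTchIII Cor. 3.12 Step (xi-f) p. 184; IUTchIV Prop. 1.2 p. 10] [claim: Mochizuki2012, status: disputed] -/
theorem GenuineK.exists_deep_place_lamSeven_localType_of_le_31 {k l : ℕ} (hk : 11 ≤ k) (hl : l.Prime) (h17 : 17 ≤ l)
    (h31 : l ≤ 31) (T : Cor22.ThetaVolumeDatumAt (ratPoint ((2 : ℚ)⁻¹ + 2 / 7 ^ k)) l) :
    letI := T.instFieldF; letI := T.instNumberFieldF; letI := T.instAlgebraF; letI := T.instFieldK
    letI := T.instNumberFieldK; letI := T.instAlgebraK; letI := T.instFieldFbar; letI := T.instAlgebraFbar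
    letI := T.instAlgebraKFbar; letI := T.instIsElliptic
    haveI : Fact (Nat.Prime 7) := ⟨by norm_num⟩
    ∃ (i : Fin (thetaIndex (pilotDataOfK T.D T.K)).lstar) (x₀ : (thetaIndex (pilotDataOfK T.D T.K)).Fibre (.inr ⟨7, by norm_num⟩)),
      (i : ℕ) = (l - 1) / 2 - 1 ∧
      placeOf (pilotDataOfK T.D T.K) 7 x₀ ∈ (pilotDataOfK T.D T.K).S ∧
      (7 : ℝ) ^ ((((i : ℕ) : ℝ) + 2) * (differentOrd 7 (kOf (pilotDataOfK T.D T.K) 7 x₀)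
          + logRadiusA 7 (absRamificationIdx 7 (kOf (pilotDataOfK T.D T.K) 7 x₀))
          + logRadiusB 7 (absRamificationIdx 7 (kOf (pilotDataOfK T.D T.K) 7 x₀))) + 1) *
        ‖(exists_realising_qIdeles_pilotDataOfK T.D).choose ⟨7, by norm_num⟩ x₀‖ ^ (((i : ℕ) + 1) ^ 2 - 1) < 1 := by
  refine GenuineK.exists_deep_place_lamSeven_of_ramBound (n := 3) (E := 60 * l) (by omega) hl (by omega) (by norm_num; omega) ?_ T
    (GenuineK.absRamificationIdx_kOf_le_sixty_mul (by omega) hl (by omega) T)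
  have hk' : 5 * 11 * ((l - 3) * (l + 1)) ≤ 5 * k * ((l - 3) * (l + 1)) :=
    Nat.mul_le_mul_right _ (Nat.mul_le_mul_left _ hk)
  refine le_trans ?_ hk'
  have h3 : 3 ≤ l := by omega
  zify [h3]
  have h17' : (17 : ℤ) ≤ (l : ℤ) := by exact_mod_cast h17
  nlinarith [mul_nonneg (sub_nonneg.mpr h17') (by positivity : (0 : ℤ) ≤ 13 * (l : ℤ) + 49)]

end Summit.ABC.IUTFork.Conditional

end
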